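import Literature.NumberTheory.EllipticCurves.ConstantKernelIsogenySelmerTrivial
import Literature.NumberTheory.NumberFields.UnramifiedCharacterClassNumber
import Literature.NumberTheory.NumberFields.CyclotomicFieldFourClassNumber
import HarnessLib

/-!
# The Selmer group of an isogeny with constant kernel of prime order `p` over a number field
# without real places vanishes in the étale/tame régime when `p ∤ h_K` (Mazur's descent, Ch. III §3,
# over `K`; in particular over `ℚ(i) = ℚ(ζ₄)`, `h = 1`)

PROOF-ONLY file (theorems, no definition, no named fact, no `sorry`), topic
`NumberTheory/EllipticCurves`.  The tree's `ConstantKernelIsogenySelmerTrivial` proves, over `ℚ`,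
Mazur's theorem (B. Mazur, *Modular curves and the Eisenstein ideal*, Publ. Math. IHÉS 47 (1977),
Ch. III §3 with Ch. I §1(g)): for an isogeny `φ : E → E'` whose kernel is fixed pointwise by
Galois, integral and étale-or-tame at every place, `Sel^φ(E/ℚ) = 0` — the only global input being
«`ℚ` has no unramified extensions» (Minkowski).  Its two LOCAL halves
(`ConstantKernelDescent.apply_eq_zero_of_mem_inertia_of_val_Δ`, `…_of_coprime`) are already stated
over an arbitrary number field `K`.  This file supplies the GLOBAL half over `K`: Minkowski is
replaced by the cyclic Hilbert class field (tree `UnramifiedCharacterClassNumber`, from the PROVED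
reciprocity `finrank_dvd_classNumber_of_isUnramifiedIn`): a `ℤ/p`-valued character of `Γ_K`
unramified everywhere is trivial as soon as `p ∤ h_K` and `K` has no real place (Mazur, Ch. I
§1(g): `h¹(Spec 𝓞_K, ℤ/p)` is governed by `Cl(K)/p` and the units).

* §1 `cocycle_eq_zero_of_forall_inertia_of_prime_card` — a constant-kernel cocycle
  `Γ_K → E[φ]`, `#E[φ] = p` prime, `p ∤ h_K`, vanishing on every inertia group is zero;
  `…_of_classNumber_eq_one` — the same for `h_K = 1` and cyclic `E[φ]` of any order.
* §2 **`selmerGroup_eq_bot_of_prime_card`** — `Sel^φ(E/K) = 0` for `W = W₀ ⊗ K` integral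
  (`W₀` over `ℤ`), `Γ_K` fixing `E[φ]` pointwise, `#E[φ] = p` prime with `p ∤ h_K`, non-zero kernel
  points integral affine, and every finite place `v` of `K` étale (`Δ(W₀) ∉ v`) or tame (`p ∉ v`,
  `gcd(p, N v − 1) = 1`); `…_of_classNumber_eq_one`; consequences `E'(K) = φ(E(K))`
  (`exists_toGeomPoints_eq_of_rational_of_prime_card`) and `Ш(E/K)[φ] = 0`
  (`ker_shaMap_eq_bot_of_prime_card`) via the tree's generic Silverman X.4.2(a) corollaries.
* §3 `ℚ(i)`: for `IsCyclotomicExtension {4} ℚ K` the two global hypotheses hold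
  (`isEmpty_ringHom_real_of_isCyclotomicExtension_four`, `classNumber_eq_one_of_isCyclotomicExtension_four`,
  from the tree's `isPrincipalIdealRing_ringOfIntegers_of_isCyclotomicExtension_four`), whence
  **`selmerGroup_eq_bot_of_isCyclotomicExtension_four`** — the `φ`-side of a `p`-isogeny descent over
  `ℚ(i)` (e.g. the `5`-descent on the Kubert–Tate family `E_{m,n} ⊗ ℚ(i)`, whose `μ₅`-side over `ℚ`
  is the tree's `KubertTateFiveMuDescent`) needs no class-field-theoretic named fact.

## References

* [Mazur1977] B. Mazur, *Modular curves and the Eisenstein ideal*, Publ. Math. IHÉS 47 (1977),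
  Ch. I §1(g) (p. 48), Ch. III §3 Thm. (3.1), Ch. III §5 (pp. 157–160).
* [SilvermanAEC2009] J. H. Silverman, *The Arithmetic of Elliptic Curves*, 2nd ed., Thm. X.4.2.
* [Cox2013] D. A. Cox, *Primes of the form x² + ny²*, 2nd ed., §5.C Cor. 5.24, §8.A Thm. 8.10.
* [FrohlichTaylor1990] A. Fröhlich, M. J. Taylor, *Algebraic Number Theory*, Ch. IV §1 (1.2)–(1.3).

## Design

Theorems only; hypotheses place by place on `v : HeightOneSpectrum (𝓞 K)` exactly as in the
`ℚ`-file (`((W₀.Δ : ℤ) : 𝓞 K) ∉ v` or `(p : 𝓞 K) ∉ v ∧ Nat.Coprime p (N v - 1)`), so that the two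
local lemmas apply verbatim.  The kernel is assumed of prime order `p` (the case of every
`p`-isogeny `E → E/⟨T⟩`, `T` a `K`-rational point of prime order `p`), which makes the character
`Γ_K → E[φ]` land in a group of order `p`.
-/

noncomputable section

open scoped Classical Pointwise
open NumberField IsDedekindDomain Field
open Literature.NumberTheory.EllipticCurves Literature.NumberTheory.GaloisRepresentations
  Literature.NumberTheory.NumberFields

universe u

namespace Literature.NumberTheory.EllipticCurves

namespace ConstantKernelDescent

variable {K : Type u} [Field K] [NumberField K] {W W' : WeierstrassCurve K} [W.IsElliptic]
  [W'.IsElliptic] (φ : WeierstrassCurve.Isogeny W W')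

/-! ## §1 Constant-kernel cocycles vanishing on inertia are zero (`p ∤ h_K`) -/

omit [W.IsElliptic] [W'.IsElliptic] in
/-- **A constant-kernel cocycle over `K` vanishing on every inertia group is zero when
`#E[φ] = p` is a prime not dividing `h_K`** (and `K` has no real place): the cocycle is a
continuous homomorphism `Γ_K → E[φ]` with open kernel (tree `cocycle_mul_of_constant`), i.e. a
`ℤ/p`-valued character unramified everywhere, hence trivial
(`NumberFields.monoidHom_eq_one_of_forall_inertia_of_prime_card`). [cite: Mazur1977, Ch. I §1(g)]
[cite: Cox2013, §5.C Cor. 5.24] -/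
theorem cocycle_eq_zero_of_forall_inertia_of_prime_card (hK : IsEmpty (K →+* ℝ))
    {p : ℕ} (hp : p.Prime) (hcard : Nat.card φ.toAddMonoidHom.ker = p)
    (hpK : ¬ p ∣ classNumber K)
    (hconst : ∀ (σ : absoluteGaloisGroup K) (P : W.geomPoints), P ∈ φ.toAddMonoidHom.ker → σ • P = P)
    (ψ : letI := φ.kerAction
      contOneCocycles (discreteTopRep (absoluteGaloisGroup K) φ.toAddMonoidHom.ker))
    (h : ∀ (v : HeightOneSpectrum (𝓞 K)), ∀ 𝔓 ∈ v.primesAbove,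
      ∀ τ ∈ 𝔓.inertia (absoluteGaloisGroup K), ψ.1 τ = 0) (σ : absoluteGaloisGroup K) :
    ψ.1 σ = 0 := by
  letI := φ.kerAction
  have h1 : ψ.1 1 = 0 := contOneCocycles.apply_one ψ
  let χ : absoluteGaloisGroup K →* Multiplicative φ.toAddMonoidHom.ker :=
    { toFun := fun s ↦ Multiplicative.ofAdd (ψ.1 s)
      map_one' := by rw [h1]; rfl
      map_mul' := fun s t ↦ by
        rw [cocycle_mul_of_constant φ hconst ψ s t, ofAdd_add] }
  have hχ : ∀ s, χ s = Multiplicative.ofAdd (ψ.1 s) := fun s ↦ rfl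
  have hker : IsOpen ((χ.ker : Subgroup (absoluteGaloisGroup K)) : Set (absoluteGaloisGroup K)) := by
    have hset : ((χ.ker : Subgroup (absoluteGaloisGroup K)) : Set (absoluteGaloisGroup K)) =
        ψ.1 ⁻¹' {0} := by
      ext s
      rw [SetLike.mem_coe, MonoidHom.mem_ker, hχ, Set.mem_preimage, Set.mem_singleton_iff]
      exact ofAdd_eq_one
    rw [hset]
    exact (isOpen_discrete _).preimage ψ.1.continuous
  have hcardM : Nat.card (Multiplicative φ.toAddMonoidHom.ker) = p := by
    rw [Nat.card_congr (Multiplicative.toAdd : Multiplicative φ.toAddMonoidHom.ker ≃ _), hcard]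
  have hone := monoidHom_eq_one_of_forall_inertia_of_prime_card hK hp hcardM hpK χ hker
    (fun v 𝔓 h𝔓 τ hτ ↦ by rw [hχ, h v 𝔓 h𝔓 τ hτ]; rfl)
  have h2 : χ σ = 1 := by rw [hone]; rfl
  rw [hχ] at h2
  exact ofAdd_eq_one.mp h2

omit [W.IsElliptic] [W'.IsElliptic] in
/-- **Class number one:** a constant-kernel cocycle over `K` (`h_K = 1`, no real place, `E[φ]`
cyclic) vanishing on every inertia group is zero. [cite: Mazur1977, Ch. I §1(g)]
[cite: Cox2013, §8.A Thm. 8.10] -/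
theorem cocycle_eq_zero_of_forall_inertia_of_classNumber_eq_one (hK : IsEmpty (K →+* ℝ))
    (h1K : classNumber K = 1) [IsAddCyclic φ.toAddMonoidHom.ker]
    (hconst : ∀ (σ : absoluteGaloisGroup K) (P : W.geomPoints), P ∈ φ.toAddMonoidHom.ker → σ • P = P)
    (ψ : letI := φ.kerAction
      contOneCocycles (discreteTopRep (absoluteGaloisGroup K) φ.toAddMonoidHom.ker))
    (h : ∀ (v : HeightOneSpectrum (𝓞 K)), ∀ 𝔓 ∈ v.primesAbove,
      ∀ τ ∈ 𝔓.inertia (absoluteGaloisGroup K), ψ.1 τ = 0) (σ : absoluteGaloisGroup K) :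
    ψ.1 σ = 0 := by
  letI := φ.kerAction
  have h1 : ψ.1 1 = 0 := contOneCocycles.apply_one ψ
  let χ : absoluteGaloisGroup K →* Multiplicative φ.toAddMonoidHom.ker :=
    { toFun := fun s ↦ Multiplicative.ofAdd (ψ.1 s)
      map_one' := by rw [h1]; rfl
      map_mul' := fun s t ↦ by
        rw [cocycle_mul_of_constant φ hconst ψ s t, ofAdd_add] }
  have hχ : ∀ s, χ s = Multiplicative.ofAdd (ψ.1 s) := fun s ↦ rfl
  have hker : IsOpen ((χ.ker : Subgroup (absoluteGaloisGroup K)) : Set (absoluteGaloisGroup K)) := by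
    have hset : ((χ.ker : Subgroup (absoluteGaloisGroup K)) : Set (absoluteGaloisGroup K)) =
        ψ.1 ⁻¹' {0} := by
      ext s
      rw [SetLike.mem_coe, MonoidHom.mem_ker, hχ, Set.mem_preimage, Set.mem_singleton_iff]
      exact ofAdd_eq_one
    rw [hset]
    exact (isOpen_discrete _).preimage ψ.1.continuous
  have hone := monoidHom_eq_one_of_forall_inertia_of_classNumber_eq_one hK h1K χ hker
    (fun v 𝔓 h𝔓 τ hτ ↦ by rw [hχ, h v 𝔓 h𝔓 τ hτ]; rfl)
  have h2 : χ σ = 1 := by rw [hone]; rfl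
  rw [hχ] at h2
  exact ofAdd_eq_one.mp h2

/-! ## §2 `Sel^φ(E/K) = 0` in the étale/tame régime -/

omit [W'.IsElliptic] in
/-- **`Sel^φ(E/K) = 0` for an isogeny with constant étale kernel of prime order in the tame régime**
(Mazur Ch. III §3 over a number field `K` without real places): `W = W₀ ⊗ K` integral, `Γ_K` fixes
`E[φ]` pointwise, `#E[φ] = p` prime with `p ∤ h_K`, the non-zero kernel points are integral affine
points, and every finite place `v` of `K` is étale (`Δ(W₀) ∉ v`) or tame (`p ∉ v`,
`gcd(p, N v - 1) = 1`).  Proof: a Selmer class is a continuous homomorphism `Γ_K → E[φ]` vanishing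
on every inertia group (the tree's two local lemmas), hence zero by §1.
[cite: Mazur1977, Ch. III §3 Thm. (3.1) with Ch. I §1(g)] -/
theorem selmerGroup_eq_bot_of_prime_card (hK : IsEmpty (K →+* ℝ))
    (W₀ : WeierstrassCurve ℤ) (hW : W = W₀.map (Int.castRingHom K))
    (hconst : ∀ (σ : absoluteGaloisGroup K) (P : W.geomPoints), P ∈ φ.toAddMonoidHom.ker → σ • P = P)
    (hint : ∀ P : W.geomPoints, P ∈ φ.toAddMonoidHom.ker → P ≠ 0 →
      ∃ (a b : ℤ) (h : (W.baseChange (AlgebraicClosure K)).toAffine.Nonsingular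
        (a : AlgebraicClosure K) (b : AlgebraicClosure K)),
        P = WeierstrassCurve.Affine.Point.some _ _ h)
    {p : ℕ} (hp : p.Prime) (hcard : Nat.card φ.toAddMonoidHom.ker = p) (hpK : ¬ p ∣ classNumber K)
    (hv : ∀ v : HeightOneSpectrum (𝓞 K), ((W₀.Δ : ℤ) : 𝓞 K) ∉ v.asIdeal ∨
      ((p : 𝓞 K) ∉ v.asIdeal ∧ Nat.Coprime p (v.residueCard - 1))) :
    φ.selmerGroup = ⊥ := by
  letI := φ.kerAction
  haveI : Finite φ.toAddMonoidHom.ker := φ.finite_ker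
  -- the kernel, of order `p`, is killed by `p`
  have hkill : ∀ P : W.geomPoints, P ∈ φ.toAddMonoidHom.ker → p • P = 0 := by
    intro P hP
    have h := card_nsmul_eq_zero' (G := φ.toAddMonoidHom.ker) (x := ⟨P, hP⟩)
    rw [hcard] at h
    have h' := congrArg Subtype.val h
    rwa [AddSubmonoidClass.coe_nsmul, ZeroMemClass.coe_zero] at h'
  rw [eq_bot_iff]
  intro c hc
  obtain ⟨ψ, rfl⟩ := oneCocycleClass_surjective
    (discreteTopRep (absoluteGaloisGroup K) φ.toAddMonoidHom.ker) c
  have hloc := ((φ.mem_selmerGroup_iff _).mp hc).1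
  have hzero : ∀ σ, ψ.1 σ = 0 := by
    refine cocycle_eq_zero_of_forall_inertia_of_prime_card φ hK hp hcard hpK hconst ψ
      fun v 𝔓 h𝔓 τ hτ ↦ ?_
    rcases hv v with hΔ | ⟨hnv, hcop⟩
    · exact apply_eq_zero_of_mem_inertia_of_val_Δ φ W₀ hW hconst hint hΔ ψ (hloc v) h𝔓 hτ
    · exact apply_eq_zero_of_mem_inertia_of_coprime φ hconst hp.pos hkill hnv hcop ψ h𝔓 hτ
  rw [AddSubgroup.mem_bot, oneCocycleClass_eq_zero_iff]
  exact ⟨0, fun g ↦ by rw [hzero g, map_zero, sub_zero]⟩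

omit [W'.IsElliptic] in
/-- **`Sel^φ(E/K) = 0`, class number one.** As `selmerGroup_eq_bot_of_prime_card`, for `h_K = 1`
and a cyclic constant kernel killed by `n ≥ 1`, every finite place étale or tame
(`n ∉ v`, `gcd(n, N v - 1) = 1`). [cite: Mazur1977, Ch. III §3 Thm. (3.1) with Ch. I §1(g)] -/
theorem selmerGroup_eq_bot_of_classNumber_eq_one (hK : IsEmpty (K →+* ℝ)) (h1K : classNumber K = 1)
    [IsAddCyclic φ.toAddMonoidHom.ker]
    (W₀ : WeierstrassCurve ℤ) (hW : W = W₀.map (Int.castRingHom K))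
    (hconst : ∀ (σ : absoluteGaloisGroup K) (P : W.geomPoints), P ∈ φ.toAddMonoidHom.ker → σ • P = P)
    (hint : ∀ P : W.geomPoints, P ∈ φ.toAddMonoidHom.ker → P ≠ 0 →
      ∃ (a b : ℤ) (h : (W.baseChange (AlgebraicClosure K)).toAffine.Nonsingular
        (a : AlgebraicClosure K) (b : AlgebraicClosure K)),
        P = WeierstrassCurve.Affine.Point.some _ _ h)
    {n : ℕ} (hn : 0 < n) (hkill : ∀ P : W.geomPoints, P ∈ φ.toAddMonoidHom.ker → n • P = 0)
    (hv : ∀ v : HeightOneSpectrum (𝓞 K), ((W₀.Δ : ℤ) : 𝓞 K) ∉ v.asIdeal ∨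
      ((n : 𝓞 K) ∉ v.asIdeal ∧ Nat.Coprime n (v.residueCard - 1))) :
    φ.selmerGroup = ⊥ := by
  letI := φ.kerAction
  rw [eq_bot_iff]
  intro c hc
  obtain ⟨ψ, rfl⟩ := oneCocycleClass_surjective
    (discreteTopRep (absoluteGaloisGroup K) φ.toAddMonoidHom.ker) c
  have hloc := ((φ.mem_selmerGroup_iff _).mp hc).1
  have hzero : ∀ σ, ψ.1 σ = 0 := by
    refine cocycle_eq_zero_of_forall_inertia_of_classNumber_eq_one φ hK h1K hconst ψ
      fun v 𝔓 h𝔓 τ hτ ↦ ?_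
    rcases hv v with hΔ | ⟨hnv, hcop⟩
    · exact apply_eq_zero_of_mem_inertia_of_val_Δ φ W₀ hW hconst hint hΔ ψ (hloc v) h𝔓 hτ
    · exact apply_eq_zero_of_mem_inertia_of_coprime φ hconst hn hkill hnv hcop ψ h𝔓 hτ
  rw [AddSubgroup.mem_bot, oneCocycleClass_eq_zero_iff]
  exact ⟨0, fun g ↦ by rw [hzero g, map_zero, sub_zero]⟩

/-- **`E'(K) = φ(E(K))`** under the hypotheses of `selmerGroup_eq_bot_of_prime_card`: every
`K`-rational point of `E'` is the image under `φ` of a `K`-rational point of `E`.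
[cite: SilvermanAEC2009, Thm. X.4.2(a)] [cite: Mazur1977, Ch. III §3 Thm. (3.1)] -/
theorem exists_toGeomPoints_eq_of_rational_of_prime_card (hK : IsEmpty (K →+* ℝ))
    (W₀ : WeierstrassCurve ℤ) (hW : W = W₀.map (Int.castRingHom K))
    (hconst : ∀ (σ : absoluteGaloisGroup K) (P : W.geomPoints), P ∈ φ.toAddMonoidHom.ker → σ • P = P)
    (hint : ∀ P : W.geomPoints, P ∈ φ.toAddMonoidHom.ker → P ≠ 0 →
      ∃ (a b : ℤ) (h : (W.baseChange (AlgebraicClosure K)).toAffine.Nonsingular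
        (a : AlgebraicClosure K) (b : AlgebraicClosure K)),
        P = WeierstrassCurve.Affine.Point.some _ _ h)
    {p : ℕ} (hp : p.Prime) (hcard : Nat.card φ.toAddMonoidHom.ker = p) (hpK : ¬ p ∣ classNumber K)
    (hv : ∀ v : HeightOneSpectrum (𝓞 K), ((W₀.Δ : ℤ) : 𝓞 K) ∉ v.asIdeal ∨
      ((p : 𝓞 K) ∉ v.asIdeal ∧ Nat.Coprime p (v.residueCard - 1)))
    (P' : W'.toAffine.Point) : ∃ P : W.toAffine.Point, W'.toGeomPoints P' = φ (W.toGeomPoints P) :=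
  exists_toGeomPoints_eq_of_selmerGroup_eq_bot φ
    (selmerGroup_eq_bot_of_prime_card φ hK W₀ hW hconst hint hp hcard hpK hv) P'

/-- **`Ш(E/K)[φ] = ker (Ш(E/K) → Ш(E'/K)) = 0`** under the hypotheses of
`selmerGroup_eq_bot_of_prime_card`. [cite: SilvermanAEC2009, Thm. X.4.2(a)]
[cite: Mazur1977, Ch. III §3 Thm. (3.1)] -/
theorem ker_shaMap_eq_bot_of_prime_card (hK : IsEmpty (K →+* ℝ))
    (W₀ : WeierstrassCurve ℤ) (hW : W = W₀.map (Int.castRingHom K))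
    (hconst : ∀ (σ : absoluteGaloisGroup K) (P : W.geomPoints), P ∈ φ.toAddMonoidHom.ker → σ • P = P)
    (hint : ∀ P : W.geomPoints, P ∈ φ.toAddMonoidHom.ker → P ≠ 0 →
      ∃ (a b : ℤ) (h : (W.baseChange (AlgebraicClosure K)).toAffine.Nonsingular
        (a : AlgebraicClosure K) (b : AlgebraicClosure K)),
        P = WeierstrassCurve.Affine.Point.some _ _ h)
    {p : ℕ} (hp : p.Prime) (hcard : Nat.card φ.toAddMonoidHom.ker = p) (hpK : ¬ p ∣ classNumber K)
    (hv : ∀ v : HeightOneSpectrum (𝓞 K), ((W₀.Δ : ℤ) : 𝓞 K) ∉ v.asIdeal ∨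
      ((p : 𝓞 K) ∉ v.asIdeal ∧ Nat.Coprime p (v.residueCard - 1))) :
    (shaMap φ.toAddMonoidHom φ.equivariant φ.hasLocalPointsMaps_toAddMonoidHom).ker = ⊥ :=
  ker_shaMap_eq_bot_of_selmerGroup_eq_bot φ
    (selmerGroup_eq_bot_of_prime_card φ hK W₀ hW hconst hint hp hcard hpK hv)

end ConstantKernelDescent

/-! ## §3 The Gaussian field `ℚ(i) = ℚ(ζ₄)`: no real place, class number one -/

namespace ConstantKernelDescent

/-- `ℚ(ζ₄)` has no real place: `ζ₄² = -1 < 0`. [cite: FrohlichTaylor1990, Ch. II §1] -/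
theorem isEmpty_ringHom_real_of_isCyclotomicExtension_four (K : Type*) [Field K] [NumberField K]
    [IsCyclotomicExtension {4} ℚ K] : IsEmpty (K →+* ℝ) := by
  have hζ := IsCyclotomicExtension.zeta_spec 4 ℚ K
  have hsq : (IsCyclotomicExtension.zeta 4 ℚ K) ^ 2 = -1 :=
    (hζ.pow (by norm_num) (show 4 = 2 * 2 by norm_num)).eq_neg_one_of_two_right
  exact isEmpty_ringHom_real_of_sq_eq (q := -1) (by norm_num) (by rw [hsq]; push_cast; rfl)

/-- `ℚ(ζ₄)` has class number one (tree: `𝓞_{ℚ(ζ₄)} = ℤ[i]` is a principal ideal domain,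
`isPrincipalIdealRing_ringOfIntegers_of_isCyclotomicExtension_four`).
[cite: FrohlichTaylor1990, Ch. IV §1 (1.2)–(1.3)] -/
theorem classNumber_eq_one_of_isCyclotomicExtension_four (K : Type) [Field K] [NumberField K]
    [IsCyclotomicExtension {4} ℚ K] : classNumber K = 1 :=
  classNumber_eq_one_iff.mpr (isPrincipalIdealRing_ringOfIntegers_of_isCyclotomicExtension_four K)

variable {K : Type} [Field K] [NumberField K] [IsCyclotomicExtension {4} ℚ K]
  {W W' : WeierstrassCurve K} [W.IsElliptic] [W'.IsElliptic] (φ : WeierstrassCurve.Isogeny W W')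

omit [W'.IsElliptic] in
/-- **`Sel^φ(E/ℚ(i)) = 0` for an isogeny with constant étale cyclic kernel in the tame régime over
the Gaussian field** — Mazur's descent over `ℚ(ζ₄)` with no class-field-theoretic hypothesis left
(`h = 1`, no real place): `W = W₀ ⊗ ℚ(i)` integral, `Γ_{ℚ(i)}` fixes `E[φ]` pointwise, `E[φ]` cyclic
killed by `n ≥ 1`, non-zero kernel points integral affine, every finite place `v` étale
(`Δ(W₀) ∉ v`) or tame (`n ∉ v`, `gcd(n, N v - 1) = 1`).  For the `5`-isogeny `E_{m,n} → E_{m,n}/⟨T⟩`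
of the Kubert–Tate family base-changed to `ℚ(i)` this is the `φ`-side of the `5`-descent over `ℚ(i)`:
tame means `5 ∤ Δ` and no bad Gaussian prime `𝔭` with `N𝔭 ≡ 1 (mod 5)` (split `ℓ ≢ 1`, inert
`ℓ ≢ ±1 (mod 5)`). [cite: Mazur1977, Ch. III §3 Thm. (3.1) with Ch. I §1(g)] -/
theorem selmerGroup_eq_bot_of_isCyclotomicExtension_four [IsAddCyclic φ.toAddMonoidHom.ker]
    (W₀ : WeierstrassCurve ℤ) (hW : W = W₀.map (Int.castRingHom K))
    (hconst : ∀ (σ : absoluteGaloisGroup K) (P : W.geomPoints), P ∈ φ.toAddMonoidHom.ker → σ • P = P)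
    (hint : ∀ P : W.geomPoints, P ∈ φ.toAddMonoidHom.ker → P ≠ 0 →
      ∃ (a b : ℤ) (h : (W.baseChange (AlgebraicClosure K)).toAffine.Nonsingular
        (a : AlgebraicClosure K) (b : AlgebraicClosure K)),
        P = WeierstrassCurve.Affine.Point.some _ _ h)
    {n : ℕ} (hn : 0 < n) (hkill : ∀ P : W.geomPoints, P ∈ φ.toAddMonoidHom.ker → n • P = 0)
    (hv : ∀ v : HeightOneSpectrum (𝓞 K), ((W₀.Δ : ℤ) : 𝓞 K) ∉ v.asIdeal ∨
      ((n : 𝓞 K) ∉ v.asIdeal ∧ Nat.Coprime n (v.residueCard - 1))) :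
    φ.selmerGroup = ⊥ :=
  selmerGroup_eq_bot_of_classNumber_eq_one φ (isEmpty_ringHom_real_of_isCyclotomicExtension_four K)
    (classNumber_eq_one_of_isCyclotomicExtension_four K) W₀ hW hconst hint hn hkill hv

/-- Over `ℚ(i)`, under the hypotheses of `selmerGroup_eq_bot_of_isCyclotomicExtension_four`:
**`E'(ℚ(i)) = φ(E(ℚ(i)))`** and **`Ш(E/ℚ(i))[φ] = 0`**. [cite: SilvermanAEC2009, Thm. X.4.2(a)]
[cite: Mazur1977, Ch. III §3 Thm. (3.1)] -/
theorem rational_eq_and_ker_shaMap_eq_bot_of_isCyclotomicExtension_four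
    [IsAddCyclic φ.toAddMonoidHom.ker]
    (W₀ : WeierstrassCurve ℤ) (hW : W = W₀.map (Int.castRingHom K))
    (hconst : ∀ (σ : absoluteGaloisGroup K) (P : W.geomPoints), P ∈ φ.toAddMonoidHom.ker → σ • P = P)
    (hint : ∀ P : W.geomPoints, P ∈ φ.toAddMonoidHom.ker → P ≠ 0 →
      ∃ (a b : ℤ) (h : (W.baseChange (AlgebraicClosure K)).toAffine.Nonsingular
        (a : AlgebraicClosure K) (b : AlgebraicClosure K)),
        P = WeierstrassCurve.Affine.Point.some _ _ h)
    {n : ℕ} (hn : 0 < n) (hkill : ∀ P : W.geomPoints, P ∈ φ.toAddMonoidHom.ker → n • P = 0)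
    (hv : ∀ v : HeightOneSpectrum (𝓞 K), ((W₀.Δ : ℤ) : 𝓞 K) ∉ v.asIdeal ∨
      ((n : 𝓞 K) ∉ v.asIdeal ∧ Nat.Coprime n (v.residueCard - 1))) :
    (∀ P' : W'.toAffine.Point, ∃ P : W.toAffine.Point, W'.toGeomPoints P' = φ (W.toGeomPoints P)) ∧
      (shaMap φ.toAddMonoidHom φ.equivariant φ.hasLocalPointsMaps_toAddMonoidHom).ker = ⊥ :=
  have h := selmerGroup_eq_bot_of_isCyclotomicExtension_four φ W₀ hW hconst hint hn hkill hv
  ⟨fun P' ↦ exists_toGeomPoints_eq_of_selmerGroup_eq_bot φ h P',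
    ker_shaMap_eq_bot_of_selmerGroup_eq_bot φ h⟩

end ConstantKernelDescent

end Literature.NumberTheory.EllipticCurves

end
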